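import Literature.Probability.LatticeModels.WeightedClusterDecomposition
import HarnessLib

/-!
# Random currents' partial monotonicity and the two-step connectivity bound (Aizenman–Duminil-Copin 2021, Appendix A: Lemma A.1, Proposition A.3)

Topic `Literature/Probability/LatticeModels`. For edge couplings `K ≥ 0` on a finite simple graph `G`
(`WeightedCurrents.lean`: currents `Current G`, `ℝ≥0∞` weights `w = Current.eweight K`, pair weights
`epairWeight K A B (n₁,n₂) = 1{∂n₁ = A} 1{∂n₂ = B} w(n₁) w(n₂)`, supported sums
`Z_{G∖T}[B] = ecurrentSumIn (offGraph G T) K B` of the graph with the edges meeting `T` removed, i.e.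
of the restricted state `⟨·⟩_{Λ∖T}`, `⟨σ_B⟩_{Λ∖T} = Z_{G∖T}[B]/Z_{G∖T}[∅]`), this file proves the
finite-volume identity and inequality of

* M. Aizenman, H. Duminil-Copin, *Marginal triviality of the scaling limits of critical 4D Ising and
  `φ⁴₄` models*, Ann. of Math. **194** (2021), arXiv:1912.07973, **Appendix A.1, Lemma A.1**
  (bib key `AizenmanDuminilCopinAnnals2021`): "Let `A, B, S` be subsets of `Λ` and `F` a
  non-negative function defined over pairs of currents, which is determined by just the values of
  `(n₁,n₂)` along the edges touching the connected cluster `C_{n₁+n₂}(S)` and such that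
  `F(n₁,n₂) = 0` whenever that cluster intersects `B` and `(∂n₁,∂n₂) = (A,B)`. Then
  `E^{A,B}_{Λ,β}[F] = E^{A,∅}_{Λ,β}[F ⟨σ_B⟩_{Λ∖C_{n₁+n₂}(S),β}/⟨σ_B⟩_{Λ,β}] ≤ E^{A,∅}_{Λ,β}[F]`."

in the un-normalised current-sum form (multiply the displayed identity by
`⟨σ_A⟩⟨σ_B⟩ Z[∅]² = Z[A] Z[B]`), for the cluster `C_{n₁+n₂}(s)` of a single vertex `s` (the case
`S = {v}` used in the proof of ADC Proposition A.3):

* `Current.tsum_epairWeight_eq_tsum_mul_offRatio` — **the identity**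
  `∑ 1{∂n₁=A}1{∂n₂=B} w w F = ∑ 1{∂n₁=A}1{∂n₂=∅} w w F · Z_{G∖C}[B]/Z_{G∖C}[∅]`, `C = C_{n₁+n₂}(s)`,
  for `F ≥ 0` local in the second current (it may depend on `n₁` arbitrarily and on `n₂` through its
  values on the edges meeting `C`, which is what the printed proof uses: its elementary `F` fixes
  `n₁ = n` entirely) and vanishing when `∂n₁ = A`, `∂n₂ = B`, `F ≠ 0` would force `C ∩ B ≠ ∅`;
* `Current.tsum_epairWeight_eq_tsum_mul_offRatio_left` — the same with the roles of the two currents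
  exchanged (sources of the *first* current moved), by the symmetry `(n₁,n₂) ↦ (n₂,n₁)`;
* `Current.offRatio_pair_mul_le` — Griffiths' inequality for the restricted state in this language,
  `(Z_{G∖T}[{a,b}]/Z_{G∖T}[∅]) · Z[∅] ≤ Z[{a,b}]` (`⟨σ_aσ_b⟩_{Λ∖T} ≤ ⟨σ_aσ_b⟩_Λ`), from the tree's
  restricted switching identity `Current.ecurrentSumIn_empty_mul_ecurrentSum_pair`;
* `Current.ecurrentSum_empty_mul_tsum_epairWeight_pair_le` — **the inequality** of Lemma A.1 for a
  pair `B = {a,b}`: `Z[∅] · ∑ 1{∂n₁=A}1{∂n₂={a,b}} w w F ≤ Z[{a,b}] · ∑ 1{∂n₁=A}1{∂n₂=∅} w w F`;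

and, from these, **Appendix A.2, Proposition A.3** (multi-point connectivity probabilities): "For
every `x, u, v ∈ ℤ^d`, `P^{0x,∅}_β[u ↔ 0] = ⟨σ₀σ_u⟩⟨σ_uσ_x⟩/⟨σ₀σ_x⟩` (first display) and
`P^{0x,∅}_β[u, v ↔ 0] ≤ (⟨σ₀σ_v⟩⟨σ_vσ_u⟩⟨σ_uσ_x⟩ + ⟨σ₀σ_u⟩⟨σ_uσ_v⟩⟨σ_vσ_x⟩)/⟨σ₀σ_x⟩` (second
display)"
("The inequality … is an important new addition … We work with finite `Λ` and then take the
limit as `Λ` tends to `ℤ^d`"), in finite volume and current-sum form: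

* `Current.two_step_connectivity_ineq` — the display "our goal is to show
  `P^{0u,ux}[v ↔ u] ≤ P^{0u,∅}[v ↔ u] + P^{∅,ux}[v ↔ u] - P^{∅,∅}[v ↔ u]`", cross-multiplied and
  subtraction-free (`c(X₁,X₂) Z₀² + c(∅,∅) Z₁Z₂ ≤ c(X₁,∅) Z₂Z₀ + c(∅,X₂) Z₁Z₀` for the connection
  masses `c`), proved as printed: Lemma A.1 four times and Griffiths termwise;
* `Current.tsum_epairWeight_double_conn_eq` — the switching step
  `P^{0x,∅}[u,v ↔ 0] · Z[0x]Z[∅] = P^{xu,0u}[v ↔ u] · Z[xu]Z[0u]`;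
* `Current.ecurrentSum_empty_mul_tsum_double_conn_le` — **the inequality of Prop. A.3**:
  `Z[∅] ∑ 1{∂n₁={0,x}}1{∂n₂=∅} w w 𝟙[u ∈ C(0)]𝟙[v ∈ C(0)] ≤ Z[0v]Z[vu]Z[ux] + Z[0u]Z[uv]Z[vx]`
  (the identity of Prop. A.3 is the tree's `Current.tsum_epairWeight_mul_indicator_mem_cluster`).

These are the finite-graph statements (general couplings `K ≥ 0`, so depleted couplings are
covered); the infinite-volume versions for `β ≤ β_c` follow by the limit `Λ ↑ ℤ^d` as in the source
and are not taken here. They are inputs of the second-moment estimates in ADC §4.2 (Lemma 4.4),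
§6.1 (Lemma 6.2) and of the mixing Theorem 6.4, on the way to the improved tree diagram bound
(`aizenmanDuminilCopin_improvedTreeDiagramBound`).

## Proof

As printed ("a fairly straightforward manipulation involving currents"): freeze the cluster
`C_{n₁+n₂}(s) = T` with the tree's decoupling identity `Current.tsum_pair_eq_sum_cluster`
(`CurrentClusters.lean`: a pair splits into inside parts `m₁, m₂` living in `T` and outside parts
`k₁, k₂` supported off `T`, weights multiply); for `T ∩ B = ∅` the sources split as `∂m₂ = ∅`,
`∂k₂ = B` (`Current.sources_add_eq_iff_of_isSupp`), `F` does not see `k₂` (locality), and the free sum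
over `k₂` produces `Z_{G∖T}[B]`; for `T ∩ B ≠ ∅` the left side vanishes by hypothesis and the right
side because `Z_{G∖T}[B] = 0` (a current off `T` has no source in `T`). Both sides of the identity
are thus `∑_T (inner sum) · Z_{G∖T}[B]` (`Current.tsum_epairWeight_mul_eq_sum_cluster`). No named fact
is introduced; everything is proved. The general-`B` inequality (`⟨σ_B⟩_{Λ∖T} ≤ ⟨σ_B⟩_Λ`, GKS) is
not needed downstream and not included.

## References

* M. Aizenman, H. Duminil-Copin, Ann. of Math. 194 (2021), arXiv:1912.07973, Appendix A.1
  (Lemma A.1 and its proof) and Appendix A.2 (Proposition A.3 and its proof; equation numbers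
  differ between the arXiv/Annals and the 2020 preprint versions and are not used here)
  [AizenmanDuminilCopinAnnals2021].
* R. Panis, arXiv:2309.05797 (2023), §4.1 (three-point identity) [Panis2023Triviality] — through
  `WeightedCurrentsIdentities.lean`.
* M. Aizenman, Comm. Math. Phys. 86 (1982), §5 (conditioning on clusters) [Aizenman1982];
  H. Tasaki, T. Hara (2015), Lemma A.19 [TasakiHara2015] — through `CurrentClusters.lean`.
-/

noncomputable section

open Finset Filter
open scoped symmDiff ENNReal

namespace Literature.Probability.LatticeModels

variable {V : Type*} [Fintype V] [DecidableEq V] {G : SimpleGraph V} [DecidableRel G.Adj]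

namespace Current

variable {K : G.edgeFinset → ℝ}

/-! ### The restricted correlation `Z_{G∖T}[B] / Z_{G∖T}[∅]` -/

/-- The restricted correlation `⟨σ_B⟩_{Λ∖T} = Z_{G∖T}[B]/Z_{G∖T}[∅]` of the graph with the edges
meeting `T` removed, in `ℝ≥0∞` (the factor `⟨σ_B⟩_{Λ∖C_{n₁+n₂}(S)}` of Aizenman–Duminil-Copin 2021,
Lemma A.1). [cite: AizenmanDuminilCopinAnnals2021, arXiv:1912.07973 Appendix A.1, Lemma A.1] -/
def offRatio (K : G.edgeFinset → ℝ) (T B : Finset V) : ℝ≥0∞ :=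
  ecurrentSumIn (offGraph G T) K B / ecurrentSumIn (offGraph G T) K ∅

/-- `Z_{G₁}[∅] ≠ 0` (the zero current contributes `1`). [folklore] -/
private theorem ecurrentSumIn_empty_ne_zero_aux (G₁ : SimpleGraph V) [DecidableRel G₁.Adj]
    (K : G.edgeFinset → ℝ) : ecurrentSumIn G₁ K (∅ : Finset V) ≠ 0 :=
  (lt_of_lt_of_le zero_lt_one (one_le_ecurrentSumIn_empty G₁ K)).ne'

/-- `∑ 1{∂n₁=A}1{∂n₂=B} w w · F ≤ Z[A] Z[B]` for `F ≤ 1`; in particular such sums are finite.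
[folklore] -/
theorem tsum_epairWeight_mul_le (A B : Finset V) {F : Current G × Current G → ℝ≥0∞}
    (hF : ∀ p, F p ≤ 1) :
    ∑' p, epairWeight K A B p * F p ≤ ecurrentSum K A * ecurrentSum K B := by
  rw [← tsum_epairWeight]
  exact ENNReal.tsum_le_tsum fun p => mul_le_of_le_one_right' (hF p)

/-- `(Z_{G∖T}[B]/Z_{G∖T}[∅]) · Z_{G∖T}[∅] = Z_{G∖T}[B]`. [folklore] -/
theorem offRatio_mul_ecurrentSumIn_empty (hK : ∀ e, 0 ≤ K e) (T B : Finset V) :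
    offRatio K T B * ecurrentSumIn (offGraph G T) K ∅ = ecurrentSumIn (offGraph G T) K B :=
  ENNReal.div_mul_cancel (ecurrentSumIn_empty_ne_zero_aux _ K) (ecurrentSumIn_ne_top _ hK _)

/-- `Z_{G∖T}[∅]/Z_{G∖T}[∅] = 1`. [folklore] -/
theorem offRatio_empty (hK : ∀ e, 0 ≤ K e) (T : Finset V) : offRatio K T (∅ : Finset V) = 1 :=
  ENNReal.div_self (ecurrentSumIn_empty_ne_zero_aux _ K) (ecurrentSumIn_ne_top _ hK _)

/-- A current supported off `T` has no source in `T`; hence `Z_{G∖T}[B] = 0` unless `T ∩ B = ∅`.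
[folklore] -/
theorem ecurrentSumIn_offGraph_eq_zero_of_not_disjoint {T B : Finset V} (h : ¬ Disjoint T B) :
    ecurrentSumIn (offGraph G T) K B = 0 := by
  unfold ecurrentSumIn
  refine ENNReal.tsum_eq_zero.2 fun n => ?_
  split_ifs with hn
  · exfalso
    refine h (Finset.disjoint_left.2 fun v hvT hvB => ?_)
    have := sources_subset_compl_of_isSupp hn.1 (hn.2 ▸ hvB)
    exact (Finset.mem_compl.1 this) hvT
  · rfl

/-- `Z_{G∖T}[B]/Z_{G∖T}[∅] = 0` unless `T ∩ B = ∅`. [folklore] -/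
theorem offRatio_eq_zero_of_not_disjoint {T B : Finset V} (h : ¬ Disjoint T B) :
    offRatio K T B = 0 := by
  rw [offRatio, ecurrentSumIn_offGraph_eq_zero_of_not_disjoint h, ENNReal.zero_div]

/-- **Griffiths' inequality for the restricted pair correlation**:
`(Z_{G∖T}[{a,b}]/Z_{G∖T}[∅]) · Z[∅] ≤ Z[{a,b}]`, i.e. `⟨σ_aσ_b⟩_{Λ∖T} ≤ ⟨σ_aσ_b⟩_Λ` — the restricted
switching identity `Z_{G∖T}[∅] Z[{a,b}] = Z_{G∖T}[{a,b}] Z[∅] + (defect ≥ 0)` of the tree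
(Aizenman–Duminil-Copin 2021, proof of Lemma A.1: "The second inequality is a trivial application of
Griffiths' inequality"). [cite: AizenmanDuminilCopinAnnals2021, arXiv:1912.07973 Appendix A.1, Lemma A.1] -/
theorem offRatio_pair_mul_le (hK : ∀ e, 0 ≤ K e) (T : Finset V) (a b : V) :
    offRatio K T ({a} ∆ {b}) * ecurrentSum K ∅ ≤ ecurrentSum K ({a} ∆ {b}) := by
  have hsw := ecurrentSumIn_empty_mul_ecurrentSum_pair (offGraph G T) hK a b
  have hle : ecurrentSumIn (offGraph G T) K ({a} ∆ {b}) * ecurrentSum K ∅ ≤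
      ecurrentSum K ({a} ∆ {b}) * ecurrentSumIn (offGraph G T) K ∅ := by
    rw [mul_comm (ecurrentSum K ({a} ∆ {b})), hsw]; exact le_self_add
  calc offRatio K T ({a} ∆ {b}) * ecurrentSum K ∅
      = ecurrentSumIn (offGraph G T) K ({a} ∆ {b}) * ecurrentSum K ∅ /
          ecurrentSumIn (offGraph G T) K ∅ := by
        rw [offRatio, div_eq_mul_inv, div_eq_mul_inv, mul_right_comm]
    _ ≤ ecurrentSum K ({a} ∆ {b}) := ENNReal.div_le_of_le_mul hle

/-! ### Conditioning on the cluster of `s`: the common value of both sides of Lemma A.1 -/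

/-- The pair weight with an extra factor, as `w(n₁) w(n₂) ·` (indicators · factor). [folklore] -/
theorem epairWeight_mul_eq (K : G.edgeFinset → ℝ) (A D : Finset V) (p : Current G × Current G)
    (f : ℝ≥0∞) :
    epairWeight K A D p * f = p.1.eweight K * p.2.eweight K *
      ((if p.1.sources = A then 1 else 0) * (if p.2.sources = D then 1 else 0) * f) := by
  unfold epairWeight
  by_cases h1 : p.1.sources = A <;> by_cases h2 : p.2.sources = D <;> simp [h1, h2]

/-- The inner sum at a frozen cluster `C_{n₁+n₂}(s) = T`: over inside pairs `(m₁, m₂)` living in `T`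
with `C_{m₁+m₂}(s) = T`, `∂m₂ = ∅`, and first outside parts `k₁` supported off `T`, of
`w(m₁) w(m₂) w(k₁) 1{∂(m₁+k₁) = A} F(m₁+k₁, m₂)`. [folklore] -/
def clusterInner (K : G.edgeFinset → ℝ) (s : V) (A : Finset V) (F : Current G × Current G → ℝ≥0∞)
    (T : Finset V) (r : (Current G × Current G) × Current G) : ℝ≥0∞ :=
  (if IsSupp (offGraph G Tᶜ) r.1.1 ∧ IsSupp (offGraph G Tᶜ) r.1.2 ∧ (r.1.1 + r.1.2).cluster s = T
      then r.1.1.eweight K * r.1.2.eweight K else 0) *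
    (if IsSupp (offGraph G T) r.2 then r.2.eweight K else 0) *
    ((if (r.1.1 + r.2).sources = A then 1 else 0) * (if r.1.2.sources = ∅ then 1 else 0) *
      F (r.1.1 + r.2, r.1.2))

/-- **Conditioning on the cluster** (the computation in the proof of Aizenman–Duminil-Copin 2021,
Lemma A.1, with a cluster functional `ρ`): for `F` local in the second current and vanishing when
`∂n₁ = A`, `∂n₂ = D`, `F ≠ 0` would force `C ∩ D ≠ ∅`,
`∑ 1{∂n₁=A}1{∂n₂=D} w w F · ρ(C) = ∑_T (∑_r clusterInner T r) · ρ(T) · Z_{G∖T}[D]`, `C = C_{n₁+n₂}(s)`.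
[cite: AizenmanDuminilCopinAnnals2021, arXiv:1912.07973 Appendix A.1, Lemma A.1, proof] -/
theorem tsum_epairWeight_mul_eq_sum_cluster (hK : ∀ e, 0 ≤ K e) (s : V) (A D : Finset V)
    (F : Current G × Current G → ℝ≥0∞) (ρ : Finset V → ℝ≥0∞)
    (hloc : ∀ n₁ n₂ n₂' : Current G,
      (∀ e : G.edgeFinset, ¬ EdgeOff ((n₁ + n₂).cluster s) (e : Sym2 V) → n₂' e = n₂ e) →
      F (n₁, n₂') = F (n₁, n₂))
    (hvan : ∀ n₁ n₂ : Current G, n₁.sources = A → n₂.sources = D → F (n₁, n₂) ≠ 0 →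
      Disjoint ((n₁ + n₂).cluster s) D) :
    ∑' p : Current G × Current G, epairWeight K A D p * (F p * ρ ((p.1 + p.2).cluster s)) =
      ∑ T : Finset V, (∑' r, clusterInner K s A F T r) * (ρ T * ecurrentSumIn (offGraph G T) K D) := by
  classical
  -- Step 0: the summand as `w w Φ`, and the decoupling identity
  have h0 : (∑' p : Current G × Current G, epairWeight K A D p * (F p * ρ ((p.1 + p.2).cluster s))) =
      ∑' p : Current G × Current G, p.1.eweight K * p.2.eweight K *
        (fun p : Current G × Current G => (if p.1.sources = A then 1 else 0) *
          (if p.2.sources = D then 1 else 0) * (F p * ρ ((p.1 + p.2).cluster s))) p :=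
    tsum_congr fun p => epairWeight_mul_eq K A D p _
  rw [h0, tsum_pair_eq_sum_cluster hK s]
  refine Finset.sum_congr rfl fun T _ => ?_
  -- reindex `((m₁,m₂),(k₁,k₂)) ↦ (((m₁,m₂),k₁),k₂)` and sum over `k₂` first
  rw [← (Equiv.prodAssoc (Current G × Current G) (Current G) (Current G)).tsum_eq,
    ENNReal.tsum_prod', ← ENNReal.tsum_mul_right]
  refine tsum_congr fun r => ?_
  obtain ⟨⟨m₁, m₂⟩, k₁⟩ := r
  simp only [Equiv.prodAssoc_apply, clusterInner]
  by_cases hin : IsSupp (offGraph G Tᶜ) m₁ ∧ IsSupp (offGraph G Tᶜ) m₂ ∧ (m₁ + m₂).cluster s = T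
  swap
  · simp only [if_neg hin, zero_mul, tsum_zero]
  obtain ⟨hm₁, hm₂, hcl⟩ := hin
  rw [if_pos ⟨hm₁, hm₂, hcl⟩]
  by_cases hk₁ : IsSupp (offGraph G T) k₁
  swap
  · have h' : ∀ k₂ : Current G, ¬ (IsSupp (offGraph G T) k₁ ∧ IsSupp (offGraph G T) k₂) :=
      fun k₂ h => hk₁ h.1
    simp only [if_neg (h' _), if_neg hk₁, mul_zero, zero_mul, tsum_zero]
  rw [if_pos hk₁]
  -- facts about outside currents `k₂`
  have hclT : ∀ {k₂ : Current G}, IsSupp (offGraph G T) k₂ →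
      ((m₁ + k₁) + (m₂ + k₂)).cluster s = T := fun {k₂} hk₂ => by
    rw [add_add_add_comm]
    exact cluster_add_eq_of_isSupp (isSupp_add hm₁ hm₂) (isSupp_add hk₁ hk₂) hcl
  have hFT : ∀ {k₂ : Current G}, IsSupp (offGraph G T) k₂ →
      F (m₁ + k₁, m₂ + k₂) = F (m₁ + k₁, m₂) := fun {k₂} hk₂ => by
    refine (hloc (m₁ + k₁) (m₂ + k₂) m₂ fun e he => ?_).symm
    rw [hclT hk₂] at he
    rw [Pi.add_apply, (isSupp_offGraph_iff.1 hk₂) e he, add_zero]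
  by_cases hTD : Disjoint T D
  · -- sources split as `∂m₂ = ∅`, `∂k₂ = D`
    have hsrc : ∀ {k₂ : Current G}, IsSupp (offGraph G T) k₂ →
        ((m₂ + k₂).sources = D ↔ m₂.sources = ∅ ∧ k₂.sources = D) := fun {k₂} hk₂ => by
      rw [sources_add_eq_iff_of_isSupp hm₂ hk₂ D, Finset.disjoint_iff_inter_eq_empty.1 hTD.symm,
        Finset.sdiff_eq_self_iff_disjoint.2 hTD.symm]
    rw [ecurrentSumIn, ← mul_assoc, ← ENNReal.tsum_mul_left]
    refine tsum_congr fun k₂ => ?_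
    by_cases hk₂ : IsSupp (offGraph G T) k₂
    · rw [if_pos ⟨hk₁, hk₂⟩, hFT hk₂, hclT hk₂]
      by_cases hD : (m₂ + k₂).sources = D
      · obtain ⟨hm₂s, hk₂s⟩ := (hsrc hk₂).1 hD
        rw [if_pos hD, if_pos hm₂s, if_pos (And.intro hk₂ hk₂s)]
        ring
      · rw [if_neg hD]
        by_cases hm₂s : m₂.sources = ∅
        · have hk₂s : ¬ (IsSupp (offGraph G T) k₂ ∧ k₂.sources = D) :=
            fun h => hD ((hsrc hk₂).2 ⟨hm₂s, h.2⟩)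
          rw [if_neg hk₂s]
          simp only [mul_zero, zero_mul]
        · rw [if_neg hm₂s]
          simp only [mul_zero, zero_mul]
    · have h1 : ¬ (IsSupp (offGraph G T) k₁ ∧ IsSupp (offGraph G T) k₂) := fun h => hk₂ h.2
      have h2 : ¬ (IsSupp (offGraph G T) k₂ ∧ k₂.sources = D) := fun h => hk₂ h.1
      rw [if_neg h1, if_neg h2]
      simp only [mul_zero, zero_mul]
  · -- the cluster meets `D`: both sides vanish
    rw [ecurrentSumIn_offGraph_eq_zero_of_not_disjoint hTD, mul_zero, mul_zero]
    refine ENNReal.tsum_eq_zero.2 fun k₂ => ?_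
    by_cases hk₂ : IsSupp (offGraph G T) k₂
    · by_cases hA : (m₁ + k₁).sources = A
      · by_cases hD : (m₂ + k₂).sources = D
        · have hF0 : F (m₁ + k₁, m₂ + k₂) = 0 := by
            by_contra hF0
            have hdis := hvan _ _ hA hD hF0
            rw [hclT hk₂] at hdis
            exact hTD hdis
          rw [hF0]
          simp only [mul_zero, zero_mul]
        · rw [if_neg hD]
          simp only [mul_zero, zero_mul]
      · rw [if_neg hA]
        simp only [mul_zero, zero_mul]
    · have h1 : ¬ (IsSupp (offGraph G T) k₁ ∧ IsSupp (offGraph G T) k₂) := fun h => hk₂ h.2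
      rw [if_neg h1]
      simp only [mul_zero, zero_mul]

/-! ### Lemma A.1 -/

/-- **Aizenman–Duminil-Copin 2021, Lemma A.1 (identity), current-sum form.** For `K ≥ 0`, a vertex
`s`, source sets `A, B`, and `F ≥ 0` on pairs of currents which depends on the second current only
through its values on the edges meeting `C = C_{n₁+n₂}(s)` and vanishes when `∂n₁ = A`, `∂n₂ = B`
and `C ∩ B ≠ ∅`:
`∑ 1{∂n₁=A} 1{∂n₂=B} w w F(n₁,n₂) = ∑ 1{∂n₁=A} 1{∂n₂=∅} w w F(n₁,n₂) · Z_{G∖C}[B]/Z_{G∖C}[∅]`,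
i.e. `E^{A,B}[F] = E^{A,∅}[F ⟨σ_B⟩_{Λ∖C}/⟨σ_B⟩_Λ]` after division by `Z[A]Z[B]`.
[cite: AizenmanDuminilCopinAnnals2021, arXiv:1912.07973 Appendix A.1, Lemma A.1] -/
theorem tsum_epairWeight_eq_tsum_mul_offRatio (hK : ∀ e, 0 ≤ K e) (s : V) (A B : Finset V)
    (F : Current G × Current G → ℝ≥0∞)
    (hloc : ∀ n₁ n₂ n₂' : Current G,
      (∀ e : G.edgeFinset, ¬ EdgeOff ((n₁ + n₂).cluster s) (e : Sym2 V) → n₂' e = n₂ e) →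
      F (n₁, n₂') = F (n₁, n₂))
    (hvan : ∀ n₁ n₂ : Current G, n₁.sources = A → n₂.sources = B → F (n₁, n₂) ≠ 0 →
      Disjoint ((n₁ + n₂).cluster s) B) :
    ∑' p : Current G × Current G, epairWeight K A B p * F p =
      ∑' p : Current G × Current G,
        epairWeight K A ∅ p * (F p * offRatio K ((p.1 + p.2).cluster s) B) := by
  have hL := tsum_epairWeight_mul_eq_sum_cluster hK s A B F (fun _ => 1) hloc hvan
  have hR := tsum_epairWeight_mul_eq_sum_cluster hK s A ∅ F (fun T => offRatio K T B) hloc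
    (fun _ _ _ _ _ => Finset.disjoint_empty_right _)
  simp only [mul_one, one_mul] at hL
  rw [hL, hR]
  refine Finset.sum_congr rfl fun T _ => ?_
  rw [offRatio_mul_ecurrentSumIn_empty hK]

/-- `epairWeight` under the exchange of the two currents. [folklore] -/
theorem epairWeight_swap (K : G.edgeFinset → ℝ) (A B : Finset V) (p : Current G × Current G) :
    epairWeight K A B p.swap = epairWeight K B A p := by
  unfold epairWeight
  rw [Prod.fst_swap, Prod.snd_swap]
  by_cases h1 : p.1.sources = B <;> by_cases h2 : p.2.sources = A <;> simp [h1, h2, mul_comm]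

/-- **Aizenman–Duminil-Copin 2021, Lemma A.1 (identity), sources of the first current.** The same
identity with the roles of the two currents exchanged: for `F ≥ 0` depending on the *first* current
only through its values on the edges meeting `C = C_{n₁+n₂}(s)` and vanishing when `∂n₁ = A`,
`∂n₂ = B` and `C ∩ A ≠ ∅`,
`∑ 1{∂n₁=A} 1{∂n₂=B} w w F = ∑ 1{∂n₁=∅} 1{∂n₂=B} w w F · Z_{G∖C}[A]/Z_{G∖C}[∅]`.
[cite: AizenmanDuminilCopinAnnals2021, arXiv:1912.07973 Appendix A.1, Lemma A.1] -/
theorem tsum_epairWeight_eq_tsum_mul_offRatio_left (hK : ∀ e, 0 ≤ K e) (s : V) (A B : Finset V)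
    (F : Current G × Current G → ℝ≥0∞)
    (hloc : ∀ n₁ n₁' n₂ : Current G,
      (∀ e : G.edgeFinset, ¬ EdgeOff ((n₁ + n₂).cluster s) (e : Sym2 V) → n₁' e = n₁ e) →
      F (n₁', n₂) = F (n₁, n₂))
    (hvan : ∀ n₁ n₂ : Current G, n₁.sources = A → n₂.sources = B → F (n₁, n₂) ≠ 0 →
      Disjoint ((n₁ + n₂).cluster s) A) :
    ∑' p : Current G × Current G, epairWeight K A B p * F p =
      ∑' p : Current G × Current G,
        epairWeight K ∅ B p * (F p * offRatio K ((p.1 + p.2).cluster s) A) := by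
  have h := tsum_epairWeight_eq_tsum_mul_offRatio hK s B A (fun p => F p.swap)
    (fun n₁ n₂ n₂' hag => hloc n₂ n₂' n₁ (fun e he => hag e (by rwa [add_comm])))
    (fun n₁ n₂ h₁ h₂ hF => by rw [add_comm]; exact hvan n₂ n₁ h₂ h₁ hF)
  rw [← (Equiv.prodComm (Current G) (Current G)).tsum_eq] at h
  conv at h => rhs; rw [← (Equiv.prodComm (Current G) (Current G)).tsum_eq]
  simp only [Equiv.prodComm_apply, Prod.swap_swap, epairWeight_swap, Prod.fst_swap,
    Prod.snd_swap] at h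
  simpa only [add_comm] using h

/-- **Aizenman–Duminil-Copin 2021, Lemma A.1 (inequality), pair case, current-sum form.** Under the
hypotheses of `tsum_epairWeight_eq_tsum_mul_offRatio` with `B = {a,b}`:
`Z[∅] · ∑ 1{∂n₁=A}1{∂n₂={a,b}} w w F ≤ Z[{a,b}] · ∑ 1{∂n₁=A}1{∂n₂=∅} w w F`, i.e.
`E^{A,{a,b}}[F] ≤ E^{A,∅}[F]` ("The second inequality is a trivial application of Griffiths'
inequality"). [cite: AizenmanDuminilCopinAnnals2021, arXiv:1912.07973 Appendix A.1, Lemma A.1] -/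
theorem ecurrentSum_empty_mul_tsum_epairWeight_pair_le (hK : ∀ e, 0 ≤ K e) (s : V) (A : Finset V)
    (a b : V) (F : Current G × Current G → ℝ≥0∞)
    (hloc : ∀ n₁ n₂ n₂' : Current G,
      (∀ e : G.edgeFinset, ¬ EdgeOff ((n₁ + n₂).cluster s) (e : Sym2 V) → n₂' e = n₂ e) →
      F (n₁, n₂') = F (n₁, n₂))
    (hvan : ∀ n₁ n₂ : Current G, n₁.sources = A → n₂.sources = {a} ∆ {b} → F (n₁, n₂) ≠ 0 →
      Disjoint ((n₁ + n₂).cluster s) ({a} ∆ {b})) :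
    ecurrentSum K ∅ * ∑' p : Current G × Current G, epairWeight K A ({a} ∆ {b}) p * F p ≤
      ecurrentSum K ({a} ∆ {b}) * ∑' p : Current G × Current G, epairWeight K A ∅ p * F p := by
  rw [tsum_epairWeight_eq_tsum_mul_offRatio hK s A ({a} ∆ {b}) F hloc hvan, ← ENNReal.tsum_mul_left,
    ← ENNReal.tsum_mul_left]
  refine ENNReal.tsum_le_tsum fun p => ?_
  calc ecurrentSum K ∅ * (epairWeight K A ∅ p * (F p * offRatio K ((p.1 + p.2).cluster s) ({a} ∆ {b})))
      = epairWeight K A ∅ p * F p * (offRatio K ((p.1 + p.2).cluster s) ({a} ∆ {b}) * ecurrentSum K ∅) := by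
        ring
    _ ≤ epairWeight K A ∅ p * F p * ecurrentSum K ({a} ∆ {b}) :=
        mul_le_mul' le_rfl (offRatio_pair_mul_le hK _ a b)
    _ = ecurrentSum K ({a} ∆ {b}) * (epairWeight K A ∅ p * F p) := by ring

/-! ### Multi-point connectivity probabilities: Proposition A.3 -/

/-- Binary rearrangement in `ℝ≥0∞`: `α ≤ Z₁`, `β ≤ Z₂` imply `α Z₂ + β Z₁ ≤ α β + Z₁ Z₂`
(expand `(Z₁ - α)(Z₂ - β) ≥ 0` without subtraction). [folklore] -/
theorem mul_add_mul_le_mul_add_mul_ennreal {α β Z₁ Z₂ : ℝ≥0∞} (ha : α ≤ Z₁) (hb : β ≤ Z₂) :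
    α * Z₂ + β * Z₁ ≤ α * β + Z₁ * Z₂ := by
  obtain ⟨c, rfl⟩ := exists_add_of_le ha
  obtain ⟨d, rfl⟩ := exists_add_of_le hb
  have : α * β + (α + c) * (β + d) = (α * (β + d) + β * (α + c)) + c * d := by ring
  rw [this]
  exact le_self_add

omit [DecidableEq V] in
/-- Locality of the cluster in the second current: if `n₂'` agrees with `n₂` on the edges meeting
`C_{n₁+n₂}(s)` then `C_{n₁+n₂'}(s) = C_{n₁+n₂}(s)`. [folklore] -/
theorem cluster_add_congr_right {n₁ n₂ n₂' : Current G} {s : V}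
    (h : ∀ e : G.edgeFinset, ¬ EdgeOff ((n₁ + n₂).cluster s) (e : Sym2 V) → n₂' e = n₂ e) :
    (n₁ + n₂').cluster s = (n₁ + n₂).cluster s :=
  cluster_eq_of_agree rfl fun e he => by rw [Pi.add_apply, Pi.add_apply, h e he]

omit [DecidableEq V] in
/-- Locality of the cluster in the first current. [folklore] -/
theorem cluster_add_congr_left {n₁ n₁' n₂ : Current G} {s : V}
    (h : ∀ e : G.edgeFinset, ¬ EdgeOff ((n₁ + n₂).cluster s) (e : Sym2 V) → n₁' e = n₁ e) :
    (n₁' + n₂).cluster s = (n₁ + n₂).cluster s :=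
  cluster_eq_of_agree rfl fun e he => by rw [Pi.add_apply, Pi.add_apply, h e he]

/-- If `∂n₂ = {o} Δ {u}` and `u ∉ C_{n₁+n₂}(v)`, then `C_{n₁+n₂}(v)` avoids `{o} Δ {u}` (the path of
`n₂` from `o` to `u`). [folklore] -/
theorem disjoint_cluster_of_sources_eq_right {n₁ n₂ : Current G} {o u v : V}
    (hs : n₂.sources = {o} ∆ {u}) (hu : u ∉ (n₁ + n₂).cluster v) :
    Disjoint ((n₁ + n₂).cluster v) ({o} ∆ {u}) := by
  rw [Finset.disjoint_right]
  intro w hw hwC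
  rcases eq_or_eq_of_mem_symmDiff_singleton hw with rfl | rfl
  · exact hu (mem_cluster_trans hwC (mem_cluster_add_of_sources_eq_right n₁ hs))
  · exact hu hwC

/-- If `∂n₁ = {x} Δ {u}` and `u ∉ C_{n₁+n₂}(v)`, then `C_{n₁+n₂}(v)` avoids `{x} Δ {u}`. [folklore] -/
theorem disjoint_cluster_of_sources_eq_left {n₁ n₂ : Current G} {x u v : V}
    (hs : n₁.sources = {x} ∆ {u}) (hu : u ∉ (n₁ + n₂).cluster v) :
    Disjoint ((n₁ + n₂).cluster v) ({x} ∆ {u}) := by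
  rw [Finset.disjoint_right]
  intro w hw hwC
  rcases eq_or_eq_of_mem_symmDiff_singleton hw with rfl | rfl
  · exact hu (mem_cluster_trans hwC
      (cluster_mono (self_le_add_right n₁ n₂) _ (mem_cluster_of_sources_eq hs)))
  · exact hu hwC

/-- The indicator `𝟙[u ∈ C_{n₁+n₂}(v)]` of the connection event `u ↔ v` in `n₁ + n₂`, in `ℝ≥0∞`.
[folklore] -/
def connInd (u v : V) (p : Current G × Current G) : ℝ≥0∞ :=
  if u ∈ (p.1 + p.2).cluster v then 1 else 0

/-- The indicator `𝟙[u ∉ C_{n₁+n₂}(v)]` of the complementary event `u ↮ v`. [folklore] -/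
def disconnInd (u v : V) (p : Current G × Current G) : ℝ≥0∞ :=
  if u ∈ (p.1 + p.2).cluster v then 0 else 1

/-- `𝟙[u ↔ v] + 𝟙[u ↮ v] = 1`. [folklore] -/
theorem connInd_add_disconnInd (u v : V) (p : Current G × Current G) :
    connInd u v p + disconnInd u v p = 1 := by
  unfold connInd disconnInd
  split_ifs <;> simp

/-- `∑ 1{∂n₁=S₁}1{∂n₂=S₂} w w (𝟙[u↔v] + 𝟙[u↮v]) = Z[S₁] Z[S₂]`. [folklore] -/
theorem tsum_connInd_add_tsum_disconnInd (S₁ S₂ : Finset V) (u v : V) :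
    ∑' p, epairWeight K S₁ S₂ p * connInd u v p + ∑' p, epairWeight K S₁ S₂ p * disconnInd u v p =
      ecurrentSum K S₁ * ecurrentSum K S₂ := by
  rw [← ENNReal.tsum_add, ← tsum_epairWeight]
  refine tsum_congr fun p => ?_
  rw [← mul_add, connInd_add_disconnInd, mul_one]

/-- **The two-step connectivity inequality** (Aizenman–Duminil-Copin 2021, proof of Prop. A.3, the
display "our goal is to show `P^{0u,ux}[v ↔ u] ≤ P^{0u,∅}[v ↔ u] + P^{∅,ux}[v ↔ u] - P^{∅,∅}[v ↔ u]`"),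
in un-normalised, subtraction-free form: with `X₁ = {x} Δ {u}`, `X₂ = {o} Δ {u}`, `Z₀ = Z[∅]`,
`Zᵢ = Z[Xᵢ]` and `c(S₁,S₂) = ∑ 1{∂n₁=S₁}1{∂n₂=S₂} w w 𝟙[u ∈ C_{n₁+n₂}(v)]`,
`c(X₁,X₂) Z₀² + c(∅,∅) Z₁Z₂ ≤ c(X₁,∅) Z₂Z₀ + c(∅,X₂) Z₁Z₀`. Proof as printed: by Lemma A.1 (twice on
each side) every disconnection mass is a sourceless mass weighted by restricted pair correlations,
which Griffiths' inequality bounds termwise. [cite: AizenmanDuminilCopinAnnals2021, arXiv:1912.07973 Appendix A.2, Prop. A.3, proof] -/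
theorem two_step_connectivity_ineq (hK : ∀ e, 0 ≤ K e) (o x u v : V) :
    (∑' p, epairWeight K ({x} ∆ {u}) ({o} ∆ {u}) p * connInd u v p) * ecurrentSum K ∅ ^ 2 +
      (∑' p, epairWeight K ∅ ∅ p * connInd u v p) *
        (ecurrentSum K ({x} ∆ {u}) * ecurrentSum K ({o} ∆ {u})) ≤
    (∑' p, epairWeight K ({x} ∆ {u}) ∅ p * connInd u v p) *
        (ecurrentSum K ({o} ∆ {u}) * ecurrentSum K ∅) +
      (∑' p, epairWeight K ∅ ({o} ∆ {u}) p * connInd u v p) *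
        (ecurrentSum K ({x} ∆ {u}) * ecurrentSum K ∅) := by
  classical
  -- locality of `𝟙[u ↮ v]` (and of the cluster itself) in either current, and vanishing
  have hdV0 : ∀ p : Current G × Current G, disconnInd u v p ≠ 0 → u ∉ (p.1 + p.2).cluster v := by
    intro p hp hu
    simp only [disconnInd, if_pos hu] at hp
    exact hp rfl
  have loc_right : ∀ n₁ n₂ n₂' : Current G,
      (∀ e : G.edgeFinset, ¬ EdgeOff ((n₁ + n₂).cluster v) (e : Sym2 V) → n₂' e = n₂ e) →
      disconnInd u v (n₁, n₂') = disconnInd u v (n₁, n₂) := fun n₁ n₂ n₂' h => by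
    simp only [disconnInd, cluster_add_congr_right h]
  have loc_left : ∀ n₁ n₁' n₂ : Current G,
      (∀ e : G.edgeFinset, ¬ EdgeOff ((n₁ + n₂).cluster v) (e : Sym2 V) → n₁' e = n₁ e) →
      disconnInd u v (n₁', n₂) = disconnInd u v (n₁, n₂) := fun n₁ n₁' n₂ h => by
    simp only [disconnInd, cluster_add_congr_left h]
  have loc_left' : ∀ n₁ n₁' n₂ : Current G,
      (∀ e : G.edgeFinset, ¬ EdgeOff ((n₁ + n₂).cluster v) (e : Sym2 V) → n₁' e = n₁ e) →
      disconnInd u v (n₁', n₂) * offRatio K (((n₁', n₂).1 + (n₁', n₂).2).cluster v) ({o} ∆ {u}) =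
        disconnInd u v (n₁, n₂) * offRatio K (((n₁, n₂).1 + (n₁, n₂).2).cluster v) ({o} ∆ {u}) :=
    fun n₁ n₁' n₂ h => by
    simp only [disconnInd, cluster_add_congr_left h]
  have van_right : ∀ (S : Finset V) (n₁ n₂ : Current G), n₁.sources = S →
      n₂.sources = {o} ∆ {u} → disconnInd u v (n₁, n₂) ≠ 0 →
      Disjoint ((n₁ + n₂).cluster v) ({o} ∆ {u}) := fun S n₁ n₂ _ h₂ hne =>
    disjoint_cluster_of_sources_eq_right (n₁ := n₁) (n₂ := n₂) (o := o) (u := u) (v := v) h₂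
      (hdV0 (n₁, n₂) hne)
  have van_left : ∀ (S : Finset V) (n₁ n₂ : Current G), n₁.sources = {x} ∆ {u} →
      n₂.sources = S → disconnInd u v (n₁, n₂) ≠ 0 →
      Disjoint ((n₁ + n₂).cluster v) ({x} ∆ {u}) := fun S n₁ n₂ h₁ _ hne =>
    disjoint_cluster_of_sources_eq_left (n₁ := n₁) (n₂ := n₂) (x := x) (u := u) (v := v) h₁
      (hdV0 (n₁, n₂) hne)
  -- Lemma A.1, four times
  have D1 : ∑' p, epairWeight K ({x} ∆ {u}) ({o} ∆ {u}) p * disconnInd u v p =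
      ∑' p, epairWeight K ({x} ∆ {u}) ∅ p *
        (disconnInd u v p * offRatio K ((p.1 + p.2).cluster v) ({o} ∆ {u})) :=
    tsum_epairWeight_eq_tsum_mul_offRatio hK v ({x} ∆ {u}) ({o} ∆ {u}) (disconnInd u v)
      loc_right (van_right ({x} ∆ {u}))
  have D4 : ∑' p, epairWeight K ({x} ∆ {u}) ∅ p *
        (disconnInd u v p * offRatio K ((p.1 + p.2).cluster v) ({o} ∆ {u})) =
      ∑' p, epairWeight K ∅ ∅ p *
        (disconnInd u v p * offRatio K ((p.1 + p.2).cluster v) ({o} ∆ {u}) *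
          offRatio K ((p.1 + p.2).cluster v) ({x} ∆ {u})) :=
    tsum_epairWeight_eq_tsum_mul_offRatio_left hK v ({x} ∆ {u}) ∅
      (fun p => disconnInd u v p * offRatio K ((p.1 + p.2).cluster v) ({o} ∆ {u})) loc_left'
      (fun n₁ n₂ h₁ h₂ hne => van_left ∅ n₁ n₂ h₁ h₂ (left_ne_zero_of_mul hne))
  have D2 : ∑' p, epairWeight K ({x} ∆ {u}) ∅ p * disconnInd u v p =
      ∑' p, epairWeight K ∅ ∅ p *
        (disconnInd u v p * offRatio K ((p.1 + p.2).cluster v) ({x} ∆ {u})) :=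
    tsum_epairWeight_eq_tsum_mul_offRatio_left hK v ({x} ∆ {u}) ∅ (disconnInd u v) loc_left
      (van_left ∅)
  have D3 : ∑' p, epairWeight K ∅ ({o} ∆ {u}) p * disconnInd u v p =
      ∑' p, epairWeight K ∅ ∅ p *
        (disconnInd u v p * offRatio K ((p.1 + p.2).cluster v) ({o} ∆ {u})) :=
    tsum_epairWeight_eq_tsum_mul_offRatio hK v ∅ ({o} ∆ {u}) (disconnInd u v) loc_right
      (van_right ∅)
  -- the inequality for the disconnection masses (Griffiths, termwise)
  have hdisc : (∑' p, epairWeight K ({x} ∆ {u}) ∅ p * disconnInd u v p) *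
        (ecurrentSum K ({o} ∆ {u}) * ecurrentSum K ∅) +
      (∑' p, epairWeight K ∅ ({o} ∆ {u}) p * disconnInd u v p) *
        (ecurrentSum K ({x} ∆ {u}) * ecurrentSum K ∅) ≤
      (∑' p, epairWeight K ({x} ∆ {u}) ({o} ∆ {u}) p * disconnInd u v p) * ecurrentSum K ∅ ^ 2 +
        (∑' p, epairWeight K ∅ ∅ p * disconnInd u v p) *
          (ecurrentSum K ({x} ∆ {u}) * ecurrentSum K ({o} ∆ {u})) := by
    rw [D2, D3, D1, D4, ← ENNReal.tsum_mul_right, ← ENNReal.tsum_mul_right,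
      ← ENNReal.tsum_mul_right, ← ENNReal.tsum_mul_right, ← ENNReal.tsum_add, ← ENNReal.tsum_add]
    refine ENNReal.tsum_le_tsum fun p => ?_
    have key := mul_add_mul_le_mul_add_mul_ennreal
      (offRatio_pair_mul_le hK ((p.1 + p.2).cluster v) x u)
      (offRatio_pair_mul_le hK ((p.1 + p.2).cluster v) o u)
    calc epairWeight K ∅ ∅ p *
            (disconnInd u v p * offRatio K ((p.1 + p.2).cluster v) ({x} ∆ {u})) *
            (ecurrentSum K ({o} ∆ {u}) * ecurrentSum K ∅) +
          epairWeight K ∅ ∅ p *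
            (disconnInd u v p * offRatio K ((p.1 + p.2).cluster v) ({o} ∆ {u})) *
            (ecurrentSum K ({x} ∆ {u}) * ecurrentSum K ∅)
        = epairWeight K ∅ ∅ p * disconnInd u v p *
            (offRatio K ((p.1 + p.2).cluster v) ({x} ∆ {u}) * ecurrentSum K ∅ *
                ecurrentSum K ({o} ∆ {u}) +
              offRatio K ((p.1 + p.2).cluster v) ({o} ∆ {u}) * ecurrentSum K ∅ *
                ecurrentSum K ({x} ∆ {u})) := by ring
      _ ≤ epairWeight K ∅ ∅ p * disconnInd u v p *
            (offRatio K ((p.1 + p.2).cluster v) ({x} ∆ {u}) * ecurrentSum K ∅ *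
                (offRatio K ((p.1 + p.2).cluster v) ({o} ∆ {u}) * ecurrentSum K ∅) +
              ecurrentSum K ({x} ∆ {u}) * ecurrentSum K ({o} ∆ {u})) := mul_le_mul' le_rfl key
      _ = epairWeight K ∅ ∅ p *
            (disconnInd u v p * offRatio K ((p.1 + p.2).cluster v) ({o} ∆ {u}) *
              offRatio K ((p.1 + p.2).cluster v) ({x} ∆ {u})) * ecurrentSum K ∅ ^ 2 +
          epairWeight K ∅ ∅ p * disconnInd u v p *
            (ecurrentSum K ({x} ∆ {u}) * ecurrentSum K ({o} ∆ {u})) := by ring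
  -- finiteness of the disconnection side
  have hfinZ : ∀ S : Finset V, ecurrentSum K S ≠ ∞ := fun S => ecurrentSum_ne_top hK S
  have hfinD : ∀ S₁ S₂ : Finset V, (∑' p, epairWeight K S₁ S₂ p * disconnInd u v p) ≠ ∞ :=
    fun S₁ S₂ => ne_top_of_le_ne_top (ENNReal.mul_ne_top (hfinZ S₁) (hfinZ S₂))
      (tsum_epairWeight_mul_le S₁ S₂ fun p => by
        unfold disconnInd; split_ifs <;> simp)
  have hfin : (∑' p, epairWeight K ({x} ∆ {u}) ({o} ∆ {u}) p * disconnInd u v p) *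
        ecurrentSum K ∅ ^ 2 +
      (∑' p, epairWeight K ∅ ∅ p * disconnInd u v p) *
        (ecurrentSum K ({x} ∆ {u}) * ecurrentSum K ({o} ∆ {u})) ≠ ∞ :=
    ENNReal.add_ne_top.2 ⟨ENNReal.mul_ne_top (hfinD _ _) (ENNReal.pow_ne_top (hfinZ _)),
      ENNReal.mul_ne_top (hfinD _ _) (ENNReal.mul_ne_top (hfinZ _) (hfinZ _))⟩
  -- `P + P' = Q + Q'` from `𝟙[u ↔ v] + 𝟙[u ↮ v] = 1`
  have e1 := tsum_connInd_add_tsum_disconnInd (K := K) ({x} ∆ {u}) ({o} ∆ {u}) u v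
  have e2 := tsum_connInd_add_tsum_disconnInd (K := K) (∅ : Finset V) ∅ u v
  have e3 := tsum_connInd_add_tsum_disconnInd (K := K) ({x} ∆ {u}) ∅ u v
  have e4 := tsum_connInd_add_tsum_disconnInd (K := K) ∅ ({o} ∆ {u}) u v
  have hPQ : (∑' p, epairWeight K ({x} ∆ {u}) ({o} ∆ {u}) p * connInd u v p) * ecurrentSum K ∅ ^ 2 +
        (∑' p, epairWeight K ∅ ∅ p * connInd u v p) *
          (ecurrentSum K ({x} ∆ {u}) * ecurrentSum K ({o} ∆ {u})) +
      ((∑' p, epairWeight K ({x} ∆ {u}) ({o} ∆ {u}) p * disconnInd u v p) * ecurrentSum K ∅ ^ 2 +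
        (∑' p, epairWeight K ∅ ∅ p * disconnInd u v p) *
          (ecurrentSum K ({x} ∆ {u}) * ecurrentSum K ({o} ∆ {u}))) =
      (∑' p, epairWeight K ({x} ∆ {u}) ∅ p * connInd u v p) *
          (ecurrentSum K ({o} ∆ {u}) * ecurrentSum K ∅) +
        (∑' p, epairWeight K ∅ ({o} ∆ {u}) p * connInd u v p) *
          (ecurrentSum K ({x} ∆ {u}) * ecurrentSum K ∅) +
      ((∑' p, epairWeight K ({x} ∆ {u}) ∅ p * disconnInd u v p) *
          (ecurrentSum K ({o} ∆ {u}) * ecurrentSum K ∅) +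
        (∑' p, epairWeight K ∅ ({o} ∆ {u}) p * disconnInd u v p) *
          (ecurrentSum K ({x} ∆ {u}) * ecurrentSum K ∅)) := by
    calc _ = ((∑' p, epairWeight K ({x} ∆ {u}) ({o} ∆ {u}) p * connInd u v p) +
              (∑' p, epairWeight K ({x} ∆ {u}) ({o} ∆ {u}) p * disconnInd u v p)) *
            ecurrentSum K ∅ ^ 2 +
          ((∑' p, epairWeight K ∅ ∅ p * connInd u v p) +
              (∑' p, epairWeight K ∅ ∅ p * disconnInd u v p)) *
            (ecurrentSum K ({x} ∆ {u}) * ecurrentSum K ({o} ∆ {u})) := by ring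
      _ = ecurrentSum K ({x} ∆ {u}) * ecurrentSum K ({o} ∆ {u}) * ecurrentSum K ∅ ^ 2 +
          ecurrentSum K ∅ * ecurrentSum K ∅ *
            (ecurrentSum K ({x} ∆ {u}) * ecurrentSum K ({o} ∆ {u})) := by rw [e1, e2]
      _ = ecurrentSum K ({x} ∆ {u}) * ecurrentSum K ∅ * (ecurrentSum K ({o} ∆ {u}) * ecurrentSum K ∅) +
          ecurrentSum K ∅ * ecurrentSum K ({o} ∆ {u}) *
            (ecurrentSum K ({x} ∆ {u}) * ecurrentSum K ∅) := by ring
      _ = ((∑' p, epairWeight K ({x} ∆ {u}) ∅ p * connInd u v p) +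
              (∑' p, epairWeight K ({x} ∆ {u}) ∅ p * disconnInd u v p)) *
            (ecurrentSum K ({o} ∆ {u}) * ecurrentSum K ∅) +
          ((∑' p, epairWeight K ∅ ({o} ∆ {u}) p * connInd u v p) +
              (∑' p, epairWeight K ∅ ({o} ∆ {u}) p * disconnInd u v p)) *
            (ecurrentSum K ({x} ∆ {u}) * ecurrentSum K ∅) := by rw [e3, e4]
      _ = _ := by ring
  have h3 : (∑' p, epairWeight K ({x} ∆ {u}) ({o} ∆ {u}) p * connInd u v p) * ecurrentSum K ∅ ^ 2 +
        (∑' p, epairWeight K ∅ ∅ p * connInd u v p) *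
          (ecurrentSum K ({x} ∆ {u}) * ecurrentSum K ({o} ∆ {u})) +
      ((∑' p, epairWeight K ({x} ∆ {u}) ({o} ∆ {u}) p * disconnInd u v p) * ecurrentSum K ∅ ^ 2 +
        (∑' p, epairWeight K ∅ ∅ p * disconnInd u v p) *
          (ecurrentSum K ({x} ∆ {u}) * ecurrentSum K ({o} ∆ {u}))) ≤
      (∑' p, epairWeight K ({x} ∆ {u}) ∅ p * connInd u v p) *
          (ecurrentSum K ({o} ∆ {u}) * ecurrentSum K ∅) +
        (∑' p, epairWeight K ∅ ({o} ∆ {u}) p * connInd u v p) *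
          (ecurrentSum K ({x} ∆ {u}) * ecurrentSum K ∅) +
      ((∑' p, epairWeight K ({x} ∆ {u}) ({o} ∆ {u}) p * disconnInd u v p) * ecurrentSum K ∅ ^ 2 +
        (∑' p, epairWeight K ∅ ∅ p * disconnInd u v p) *
          (ecurrentSum K ({x} ∆ {u}) * ecurrentSum K ({o} ∆ {u}))) := by
    rw [hPQ]
    exact add_le_add le_rfl hdisc
  exact ENNReal.le_of_add_le_add_right hfin h3

/-- The three-point identity read from the other endpoint:
`∑ 1{∂n₁={x,u}}1{∂n₂=∅} w w 𝟙[u ∈ C(v)] = Z[{x,v}] Z[{u,v}]`. [cite: Panis2023Triviality, §4.1] -/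
theorem tsum_epairWeight_pair_empty_mul_connInd (hK : ∀ e, 0 ≤ K e) (x u v : V) :
    ∑' p, epairWeight K ({x} ∆ {u}) ∅ p * connInd u v p =
      ecurrentSum K ({x} ∆ {v}) * ecurrentSum K ({u} ∆ {v}) := by
  rw [symmDiff_comm ({x} : Finset V) {u}, ← tsum_epairWeight_mul_indicator_mem_cluster hK u x v]
  refine tsum_congr fun p => ?_
  unfold connInd
  simp only [mem_cluster_comm (x := v) (v := u)]

/-- The three-point identity with the pair of sources on the second current:
`∑ 1{∂n₁=∅}1{∂n₂={o,u}} w w 𝟙[u ∈ C(v)] = Z[{u,v}] Z[{o,v}]`. [cite: Panis2023Triviality, §4.1] -/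
theorem tsum_epairWeight_empty_pair_mul_connInd (hK : ∀ e, 0 ≤ K e) (o u v : V) :
    ∑' p, epairWeight K ∅ ({o} ∆ {u}) p * connInd u v p =
      ecurrentSum K ({u} ∆ {v}) * ecurrentSum K ({o} ∆ {v}) := by
  rw [← tsum_epairWeight_mul_indicator_mem_cluster hK o u v,
    ← (Equiv.prodComm (Current G) (Current G)).tsum_eq]
  refine tsum_congr fun p => ?_
  simp only [Equiv.prodComm_apply, epairWeight_swap]
  unfold connInd
  rw [Prod.fst_swap, Prod.snd_swap, add_comm p.2 p.1]
  by_cases hs : p.1.sources = {o} ∆ {u}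
  · have huo : u ∈ (p.1 + p.2).cluster o :=
      cluster_mono (self_le_add_right p.1 p.2) _ (mem_cluster_of_sources_eq hs)
    have hiff : u ∈ (p.1 + p.2).cluster v ↔ v ∈ (p.1 + p.2).cluster o := by
      rw [mem_cluster_iff, mem_cluster_iff]
      rw [mem_cluster_iff] at huo
      exact ⟨fun h => huo.trans h.symm, fun h => h.symm.trans huo⟩
    simp only [hiff]
  · rw [epairWeight_eq_mul, if_neg hs, zero_mul, zero_mul, zero_mul]

/-- **Switching for the double connection** (Aizenman–Duminil-Copin 2021, proof of Prop. A.3: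
"use the switching lemma to find `P^{0x,∅}[u,v ↔ 0] = ⟨σ₀σ_u⟩⟨σ_uσ_x⟩/⟨σ₀σ_x⟩ · P^{0u,ux}[v ↔ u]`"),
current-sum form: `∑ 1{∂n₁={o,x}}1{∂n₂=∅} w w 𝟙[u ∈ C(o)] 𝟙[v ∈ C(o)] =
∑ 1{∂n₁={x,u}}1{∂n₂={o,u}} w w 𝟙[u ∈ C(v)]`. [cite: AizenmanDuminilCopinAnnals2021, arXiv:1912.07973 Appendix A.2, Prop. A.3, proof] -/
theorem tsum_epairWeight_double_conn_eq (hK : ∀ e, 0 ≤ K e) (o x u v : V) :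
    ∑' p, epairWeight K ({o} ∆ {x}) ∅ p *
        ((if u ∈ (p.1 + p.2).cluster o then 1 else 0) * (if v ∈ (p.1 + p.2).cluster o then 1 else 0)) =
      ∑' p, epairWeight K ({x} ∆ {u}) ({o} ∆ {u}) p * connInd u v p := by
  have h := tsum_epairWeight_switch_pair hK ({o} ∆ {x}) o u (fun m => if u ∈ m.cluster v then 1 else 0)
  rw [symmDiff_symmDiff_symmDiff_left] at h
  unfold connInd
  rw [h]
  refine tsum_congr fun p => ?_
  congr 1
  by_cases huo : u ∈ (p.1 + p.2).cluster o
  · have hiff : v ∈ (p.1 + p.2).cluster o ↔ u ∈ (p.1 + p.2).cluster v := by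
      rw [mem_cluster_iff, mem_cluster_iff]
      rw [mem_cluster_iff] at huo
      exact ⟨fun h => h.symm.trans huo, fun h => huo.trans h.symm⟩
    simp only [if_pos huo, hiff, one_mul, mul_one]
  · simp only [if_neg huo, zero_mul, mul_zero]

/-- **Aizenman–Duminil-Copin 2021, Proposition A.3, the inequality (the two-step random-walk type
bound), finite volume, current-sum form.** For couplings `K ≥ 0` on a finite graph and vertices `o, x, u, v`
(printed: `0, x, u, v ∈ ℤ^d`; "We work with finite `Λ` and then take the limit"):
`Z[∅] · ∑ 1{∂n₁={o,x}}1{∂n₂=∅} w w 𝟙[u ∈ C_{n₁+n₂}(o)] 𝟙[v ∈ C_{n₁+n₂}(o)]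
  ≤ Z[{o,v}] Z[{v,u}] Z[{u,x}] + Z[{o,u}] Z[{u,v}] Z[{v,x}]`,
i.e. after division by `Z[{o,x}] Z[∅]³`,
`P^{0x,∅}[u, v ↔ 0 in n₁+n₂] ≤ (⟨σ₀σ_v⟩⟨σ_vσ_u⟩⟨σ_uσ_x⟩ + ⟨σ₀σ_u⟩⟨σ_uσ_v⟩⟨σ_vσ_x⟩)/⟨σ₀σ_x⟩`
("an important new addition … Its structure suggests a more general `k`-step random walk type bound,
but the present proof does not extend to `k > 2`"). The companion identity of Prop. A.3,
`P^{0x,∅}[u ↔ 0] = ⟨σ₀σ_u⟩⟨σ_uσ_x⟩/⟨σ₀σ_x⟩`, is the tree's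
`Current.tsum_epairWeight_mul_indicator_mem_cluster`.
[cite: AizenmanDuminilCopinAnnals2021, arXiv:1912.07973 Appendix A.2, Proposition A.3] -/
theorem ecurrentSum_empty_mul_tsum_double_conn_le (hK : ∀ e, 0 ≤ K e) (o x u v : V) :
    ecurrentSum K ∅ * ∑' p, epairWeight K ({o} ∆ {x}) ∅ p *
        ((if u ∈ (p.1 + p.2).cluster o then 1 else 0) * (if v ∈ (p.1 + p.2).cluster o then 1 else 0)) ≤
      ecurrentSum K ({o} ∆ {v}) * ecurrentSum K ({v} ∆ {u}) * ecurrentSum K ({u} ∆ {x}) +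
        ecurrentSum K ({o} ∆ {u}) * ecurrentSum K ({u} ∆ {v}) * ecurrentSum K ({v} ∆ {x}) := by
  have h0 : ecurrentSum K (∅ : Finset V) ≠ 0 := ecurrentSum_empty_ne_zero K
  have htop : ecurrentSum K (∅ : Finset V) ≠ ∞ := ecurrentSum_ne_top hK ∅
  rw [tsum_epairWeight_double_conn_eq hK o x u v, mul_comm]
  -- from the two-step inequality, dropping the sourceless term and one factor `Z[∅]`
  have h2 := two_step_connectivity_ineq hK o x u v
  have h3 : (∑' p, epairWeight K ({x} ∆ {u}) ({o} ∆ {u}) p * connInd u v p) * ecurrentSum K ∅ *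
      ecurrentSum K ∅ ≤
      ((∑' p, epairWeight K ({x} ∆ {u}) ∅ p * connInd u v p) * ecurrentSum K ({o} ∆ {u}) +
        (∑' p, epairWeight K ∅ ({o} ∆ {u}) p * connInd u v p) * ecurrentSum K ({x} ∆ {u})) *
        ecurrentSum K ∅ := by
    calc _ = (∑' p, epairWeight K ({x} ∆ {u}) ({o} ∆ {u}) p * connInd u v p) * ecurrentSum K ∅ ^ 2 := by
          ring
      _ ≤ _ := le_self_add
      _ ≤ _ := h2
      _ = _ := by ring
  have h4 := (ENNReal.mul_le_mul_iff_left h0 htop).1 h3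
  rw [tsum_epairWeight_pair_empty_mul_connInd hK, tsum_epairWeight_empty_pair_mul_connInd hK] at h4
  calc _ ≤ _ := h4
    _ = _ := by
      rw [symmDiff_comm ({x} : Finset V) {v}, symmDiff_comm ({u} : Finset V) {x},
        symmDiff_comm ({v} : Finset V) {u}]
      ring

end Current

end Literature.Probability.LatticeModels
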